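import Summits.HodgeConjecture.HodgeConjecture.Theorems.K2E5QuatNrdLevelTwoPImage     -- ★ G12 brick I (this seat): `scalar_mem_quatLocalLevelTwoP`, ⊆-pattern; brings ★ `K2E5QuatLocalDetImage`, ★ square roots near 1
import Summits.HodgeConjecture.HodgeConjecture.Theorems.K2E5BetaDetImageIndex         -- ★ F6 (this seat): `det_one_add_fin_two`, `mul_mem_ballMat_mul`, `natCard_map_mk'`; brings ★ `UnitaryFinCayleyWindow` (`ballMat`, `isUnit_det_one_add`)
import Literature.NumberTheory.Weil1982.UnitaryFinLieBallDualCompact                  -- ★ `valued_twoP_apply_lt_one`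
import HarnessLib

/-!
# K2 ∕ E5 «TamagawaUnitary», unit G (ZETA) — G12 brick D-b1 (`K2E5QuatNrdImageDyadic`): **`ι(1 + (2p)²𝒪_v) ≤ Nrd(Λ_v^×(2p)(h)) ≤ ι(1 + 2p𝒪_v)` at EVERY finite place,
# for EVERY hermitian plane `h`**, and the translate `1 + B_v ⊆ Λ_v^×(2p)`

Cell `hodgecm-mathlib` (Track B «K2-LIT»), engine E5, item h413 = `stmt-HodgeConjecture-24833` (helper, `--supports … --as helper`); dealer K2E5-plan (g2) DEALS BATCH #10 (3): «p15 ↦ G12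
`Zeta.sig_K2E5QuatNrdLevelIndex`» — dyadic half, brick D-b1 (REPORT-FIRST 2026-09-04, K2/STATUS.md).  Author K2E5-p15 (g0).  THEOREMS ONLY.

WHAT (all places `v`, `c = 2p`, `K = Λ_v^×(c)` = ★ `quatLocalLevelTwoP`, `Nrd = det`):
* §1 `map_det_quatLocalLevelTwoP_le` — `Nrd K ≤ ι(1 + c𝒪_v)` (the ⊆-half of brick I, valid at every place).
* §2 `exists_levelTwoP_val_eq_one_add` — the TRANSLATE: every `x ∈ B_v = D_v ∩ c·M₂(𝒪_{E_v})` gives `1 + x ∈ K` (★ `isUnit_det_one_add`, ★ `nonsing_inv_one_add_mem_intMatrices`).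
* §3 `sqrt_unique`, `exists_sqrt_fixed_sq` — `σ`-FIXED square roots at radius `c²`: a `σ`-fixed `u = 1 + c²t` is `s²`, `s = 1 + c·t′`, `s̄ = s` (componentwise strong Hensel ★
  `exists_mul_self_eq_of_valued_sub_one_lt_four_adicCompletion`, `|c²| < |4|` at EVERY place; Galois-fixed by uniqueness of the root within `|· − 1| < |2|`).
* §4 `unitsMap_preimage_mem_ker_natCast` — `ι t = 1 + m·s` (`s ∈ 𝒪_{E_v}`, `m ∈ ℕ` a unit of `E_v`) ⇒ `t ≡ 1 (m)`.
* §5 `levelSq_le_map_det` — `ι(1 + c²𝒪_v) ≤ Nrd K`: `ι(t) = s²` and the SCALAR `s·1₂ ∈ K` (brick I §2) has `Nrd = s²`.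

HONEST LABEL: HC_CM is proved only modulo the 7 printed citations (2 remaining named inputs: hLiu418 = stmt-HodgeConjecture-24832, h413 = stmt-HodgeConjecture-24833) until rung 0
closes; this helper closes no socket and changes no count.

## References
* [VignerasLNM800] M.-F. Vignéras, LNM 800 — Ch. II §2 (`n(𝒪_v^×) ⊂ R_v^×`), Ch. II §4 Lemme 4.6.
* [Serre1979] J.-P. Serre, *Local Fields* — Ch. II §4 Prop. 7 (Hensel), Ch. XIV §4 (filtration of units, squares).
* [PlatonovRapinchuk1994] V. Platonov, A. Rapinchuk (1994) — §3.3 (congruence subgroups, the translate window), §5.1.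
-/

set_option autoImplicit false
set_option linter.dupNamespace false

noncomputable section

namespace Summit.HodgeConjecture.HodgeConjecture.Cruxes.H413.K2E5QuatNrdImageDyadic

open NumberField IsDedekindDomain
open scoped NNReal MatrixGroups Matrix
open Literature.NumberTheory.Automorphic Literature.NumberTheory.Automorphic.UnitaryGroup
open Literature.NumberTheory.Weil1982.UnitaryFinTopForm
open Summit.HodgeConjecture.HodgeConjecture.Cruxes.H413.K2E5QuatLocalMeasure

variable (L : Type) [Field L] [NumberField L] [IsCMField L] (H : Matrix (Fin 2) (Fin 2) L) (v : HeightOneSpectrum (𝓞 ↥(maximalRealSubfield L)))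

/-! ## §1 `Nrd(Λ_v^×(2p)) ≤ ι(1 + 2p𝒪_v)` at every place -/

/-- **`Nrd(Λ_v^×(2p)(h)) ⊆ ι(1 + 2p·𝒪_v)` at EVERY finite place, for every plane with `det h ≠ 0`**: the reduced norm of `g ∈ Λ_v^×(2p)` is `σ`-fixed (★ `conjLocal_det_eq_det_of_mem_quatLocal`)
with `det, det⁻¹` integral, hence `ι` of a unit `t` (★ `exists_unitsMap_eq_of_conjLocal_eq`), and `det(1 + 2pY) ≡ 1 (2p)` (★ `exists_det_eq_one_add_twoP_mul`, ★ `unitsMap_preimage_mem_ker`).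
[cite: VignerasLNM800, Ch. II §2] [cite: PlatonovRapinchuk1994, §3.3] -/
theorem map_det_quatLocalLevelTwoP_le (hdet : H.det ≠ 0) :
    (quatLocalLevelTwoP L H v).map (Matrix.GeneralLinearGroup.det : GL (Fin 2) (LocalRing L v) →* (LocalRing L v)ˣ) ≤
      ((Units.map (Ideal.Quotient.mk (Ideal.span {((2 * resChar L v : ℕ) : v.adicCompletionIntegers ↥(maximalRealSubfield L))})).toMonoidHom).ker).map
        (Units.map (((algebraMap (v.adicCompletion ↥(maximalRealSubfield L)) (LocalRing L v)).comp
          (v.adicCompletionIntegers ↥(maximalRealSubfield L)).subtype).toMonoidHom)) := by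
  rintro _ ⟨x, hx, rfl⟩
  obtain ⟨hxU, hx1, -⟩ := (mem_quatLocalLevelTwoP_iff L H v x).1 hx
  have hxL := quatLocalLevelTwoP_le_quatLocalUnitsLevel L H v hx
  obtain ⟨-, hxi, hxi'⟩ := (mem_quatLocalUnitsLevel_iff L H v x).1 hxL
  have hσ : conjLocal L (IsCMField.complexConj L) v ↑(Matrix.GeneralLinearGroup.det x) = ↑(Matrix.GeneralLinearGroup.det x) :=
    K2E5QuatLocalDetImage.conjLocal_det_eq_det_of_mem_quatLocal L H v hdet ((mem_quatLocalUnits_iff L H v x).1 hxU)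
  have hO : (↑(Matrix.GeneralLinearGroup.det x) : LocalRing L v) ∈ localIntegers L v := K2E5BetaDetIndexCalculus.det_mem_localIntegers L 2 v hxi
  have hO' : (↑(Matrix.GeneralLinearGroup.det x)⁻¹ : LocalRing L v) ∈ localIntegers L v := by
    rw [← map_inv]; exact K2E5BetaDetIndexCalculus.det_mem_localIntegers L 2 v hxi'
  obtain ⟨t, ht⟩ := K2E5QuatLocalDetImage.exists_unitsMap_eq_of_conjLocal_eq L v hσ hO hO'
  obtain ⟨s, hs, hds⟩ := K2E5BetaDetIndexCalculus.exists_det_eq_one_add_twoP_mul L v hx1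
  exact ⟨t, K2E5QuatLocalDetImage.unitsMap_preimage_mem_ker L v hs ((congrArg Units.val ht).trans hds), ht⟩

/-! ## §2 The translate: `1 + B_v ⊆ Λ_v^×(2p)` -/

/-- **`1 + x ∈ Λ_v^×(2p)(h)` for every `x ∈ B_v = D_v ∩ 2p·M₂(𝒪_{E_v})`** (every place): `det(1 + x)` is a unit (★ `isUnit_det_one_add`), `1 + x ∈ D_v`, `(1+x) − 1 = x ∈ 2pM`, and
`(1+x)⁻¹ − 1 = −(1+x)⁻¹x ∈ M·2pM ⊆ 2pM` (★ `nonsing_inv_one_add_mem_intMatrices`).  The unit is Mathlib's `Matrix.nonsingInvUnit`. [cite: PlatonovRapinchuk1994, §3.3] -/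
theorem exists_levelTwoP_val_eq_one_add {x : Matrix (Fin 2) (Fin 2) (LocalRing L v)} (hx : x ∈ quatLocalBall L H v) :
    ∃ g ∈ quatLocalLevelTwoP L H v, (g : GL (Fin 2) (LocalRing L v)).val = 1 + x := by
  obtain ⟨hxD, hx2⟩ := (mem_quatLocalBall_iff L H v x).1 hx
  have hx2' : x ∈ ballMat L 2 v (twoP L v) := by rw [ballMat_twoP]; exact hx2
  have hsmall : ∀ i j (w : PlacesOver L v), Valued.v (x i j w) < 1 := valued_apply_lt_one_of_mem_ballMat L 2 v (valued_twoP_apply_lt_one L v) hx2'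
  have hU : IsUnit (1 + x).det := isUnit_det_one_add L 2 v hsmall
  refine ⟨(1 + x).nonsingInvUnit hU, (mem_quatLocalLevelTwoP_iff L H v _).2 ⟨?_, ?_, ?_⟩, rfl⟩
  · rw [mem_quatLocalUnits_iff]
    change 1 + x ∈ quatLocal L H v
    exact (quatLocal L H v).add_mem (quatLocal L H v).one_mem hxD
  · change 1 + x - 1 ∈ twoPIntMatrices L 2 v
    rw [add_sub_cancel_left]; exact hx2
  · change (1 + x)⁻¹ - 1 ∈ twoPIntMatrices L 2 v
    have h := Matrix.nonsing_inv_mul (1 + x) hU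
    rw [Matrix.mul_add, Matrix.mul_one] at h
    have e : (1 + x)⁻¹ - 1 = -((1 + x)⁻¹ * x) := by rw [sub_eq_iff_eq_add, neg_add_eq_sub, eq_sub_iff_add_eq, h]
    rw [e]
    exact (twoPIntMatrices L 2 v).neg_mem (mul_mem_twoPIntMatrices_right L 2 v (nonsing_inv_one_add_mem_intMatrices L 2 v hsmall) hx2)

/-! ## §3 σ-fixed square roots at radius `(2p)²`, every place -/

omit [IsCMField L] in
/-- **Uniqueness of the square root within `|· − 1| < |2|`** (every place): `a² = b²`, `|a − 1| < |2|`, `|b − 1| < |2| ⇒ a = b` (`(a−b)(a+b) = 0` and `|a + b| = |2| ≠ 0`). [cite: Serre1979, Ch. XIV §4] -/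
theorem sqrt_unique (w : PlacesOver L v) {a b : w.1.adicCompletion L} (hab : a * a = b * b)
    (ha : Valued.v (a - 1) < Valued.v (2 : w.1.adicCompletion L)) (hb : Valued.v (b - 1) < Valued.v (2 : w.1.adicCompletion L)) : a = b := by
  haveI : CharZero (w.1.adicCompletion L) := charZero_of_injective_algebraMap (algebraMap L (w.1.adicCompletion L)).injective
  have h20 : Valued.v (2 : w.1.adicCompletion L) ≠ 0 := (Valuation.ne_zero_iff _).2 two_ne_zero
  have hsum : a + b ≠ 0 := fun h => by
    have e : Valued.v (a + b) = Valued.v (2 : w.1.adicCompletion L) := by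
      rw [show a + b = 2 + ((a - 1) + (b - 1)) by ring, Valuation.map_add_eq_of_lt_left _ (Valuation.map_add_lt _ ha hb)]
    rw [h, map_zero] at e
    exact h20 e.symm
  have e0 : (a - b) * (a + b) = 0 := by
    calc (a - b) * (a + b) = a * a - b * b := by ring
      _ = 0 := by rw [hab, sub_self]
  exact sub_eq_zero.1 ((mul_eq_zero.1 e0).resolve_right hsum)

omit [IsCMField L] in
/-- `|u_w − 1| < |4|` for `u = 1 + (2p)²·t`, `t` integral, at EVERY place (`|(2p)²| = |4|·|p|²`, `|p| < 1`). [cite: Serre1979, Ch. XIV §4] -/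
theorem valued_sub_one_lt_four_sq {u t : LocalRing L v} (ht : t ∈ localIntegers L v) (hu : u = 1 + twoP L v * twoP L v * t) (w : PlacesOver L v) :
    Valued.v (u w - 1) < Valued.v (4 : w.1.adicCompletion L) := by
  haveI : CharZero (w.1.adicCompletion L) := charZero_of_injective_algebraMap (algebraMap L (w.1.adicCompletion L)).injective
  have huw : u w - 1 = twoP L v w * twoP L v w * t w := by rw [hu]; simp [Pi.add_apply, Pi.mul_apply]
  have ht1 : Valued.v (t w) ≤ 1 := (mem_integer_iff_valued_le_one L v w _).1 ((mem_localIntegers_iff L v t).1 ht w)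
  have h2p : twoP L v w = 2 * ((resChar L v : ℕ) : LocalRing L v) w := by
    rw [twoP]; simp [Nat.cast_mul]
  have hpp : Valued.v (((resChar L v : ℕ) : LocalRing L v) w) < 1 := valued_resChar_apply_lt_one L v w
  have h2 : Valued.v (2 : w.1.adicCompletion L) ≠ 0 := (Valuation.ne_zero_iff _).2 two_ne_zero
  have hsmall : Valued.v (((resChar L v : ℕ) : LocalRing L v) w) * Valued.v (((resChar L v : ℕ) : LocalRing L v) w) * Valued.v (t w) < 1 :=
    mul_lt_one_of_lt_of_le (mul_lt_one_of_lt_of_le hpp hpp.le) ht1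
  have e : Valued.v (u w - 1) =
      (Valued.v (((resChar L v : ℕ) : LocalRing L v) w) * Valued.v (((resChar L v : ℕ) : LocalRing L v) w) * Valued.v (t w)) *
        (Valued.v (2 : w.1.adicCompletion L) * Valued.v (2 : w.1.adicCompletion L)) := by
    rw [huw, h2p, map_mul, map_mul, map_mul]; ac_rfl
  rw [e, show (4 : w.1.adicCompletion L) = 2 * 2 by norm_num, map_mul]
  calc _ < 1 * (Valued.v (2 : w.1.adicCompletion L) * Valued.v (2 : w.1.adicCompletion L)) := mul_lt_mul_of_pos_right hsmall (zero_lt_iff.2 (mul_ne_zero h2 h2))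
    _ = _ := one_mul _

/-- **σ-FIXED square roots at radius `(2p)²`, EVERY place**: a `σ`-fixed `u = 1 + (2p)²·t` (`t ∈ 𝒪_{E_v}`) is `s²` with `s = 1 + 2p·t′` (`t′ ∈ 𝒪_{E_v}`), `s̄ = s`, `|s_w| = 1`.
[cite: Serre1979, Ch. II §4 Prop. 7; Ch. XIV §4] [cite: PlatonovRapinchuk1994, §3.3] -/
theorem exists_sqrt_fixed_sq {u t : LocalRing L v} (ht : t ∈ localIntegers L v) (hu : u = 1 + twoP L v * twoP L v * t)
    (hσ : conjLocal L (IsCMField.complexConj L) v u = u) :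
    ∃ s : LocalRing L v, s * s = u ∧ (∃ t' ∈ localIntegers L v, s = 1 + twoP L v * t') ∧ conjLocal L (IsCMField.complexConj L) v s = s ∧
      ∀ w : PlacesOver L v, Valued.v (s w) = 1 := by
  choose r hr using fun w : PlacesOver L v => Literature.NumberTheory.LocalFields.exists_mul_self_eq_of_valued_sub_one_lt_four_adicCompletion L w.1 (u w)
    (valued_sub_one_lt_four_sq L v ht hu w)
  have hch : ∀ w : PlacesOver L v, CharZero (w.1.adicCompletion L) := fun w => charZero_of_injective_algebraMap (algebraMap L (w.1.adicCompletion L)).injective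
  have h20 : ∀ w : PlacesOver L v, Valued.v (2 : w.1.adicCompletion L) ≠ 0 := fun w => by
    haveI := hch w; exact (Valuation.ne_zero_iff _).2 two_ne_zero
  have h21 : ∀ w : PlacesOver L v, Valued.v (2 : w.1.adicCompletion L) ≤ 1 := fun w =>
    (mem_integer_iff_valued_le_one L v w _).1 ((mem_localIntegers_iff L v _).1 (two_mem_localIntegers L v) w)
  have hr1 : ∀ w, Valued.v (r w - 1) < Valued.v (2 : w.1.adicCompletion L) := fun w => (hr w).2
  have hr1' : ∀ w, Valued.v (r w - 1) < 1 := fun w => lt_of_lt_of_le (hr1 w) (h21 w)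
  have hrp : ∀ w, Valued.v (r w + 1) = Valued.v (2 : w.1.adicCompletion L) := fun w => by
    rw [show r w + 1 = 2 + (r w - 1) by ring, Valuation.map_add_eq_of_lt_left _ (hr1 w)]
  have h2p : ∀ w, twoP L v w = 2 * ((resChar L v : ℕ) : LocalRing L v) w := fun w => by rw [twoP]; simp [Nat.cast_mul]
  have huw : ∀ w, u w = 1 + twoP L v w * twoP L v w * t w := fun w => by rw [hu]; rfl
  have hrr : r * r = u := funext fun w => (hr w).1
  let t' : LocalRing L v := fun w => (r w - 1) / twoP L v w
  have ht'O : t' ∈ localIntegers L v := by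
    refine (mem_localIntegers_iff L v t').2 fun w => (mem_integer_iff_valued_le_one L v w (t' w)).2 ?_
    have ht1 : Valued.v (t w) ≤ 1 := (mem_integer_iff_valued_le_one L v w _).1 ((mem_localIntegers_iff L v t).1 ht w)
    have hp1 : Valued.v (((resChar L v : ℕ) : LocalRing L v) w) ≤ 1 := (valued_resChar_apply_lt_one L v w).le
    have e1 : (r w - 1) * (r w + 1) = twoP L v w * twoP L v w * t w := by
      calc (r w - 1) * (r w + 1) = r w * r w - 1 := by ring
        _ = twoP L v w * twoP L v w * t w := by rw [(hr w).1, huw w]; ring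
    -- `t′_w · (r_w + 1) = 2p · t_w`, hence `|t′_w| · |2| = |2| · |p| · |t_w|`
    have e2 : t' w * (r w + 1) = twoP L v w * t w := by
      change (r w - 1) / twoP L v w * (r w + 1) = _
      rw [div_mul_eq_mul_div, e1, mul_assoc, mul_div_cancel_left₀ _ (twoP_apply_ne_zero L v w)]
    have e3 : Valued.v (t' w) * Valued.v (2 : w.1.adicCompletion L) = Valued.v (twoP L v w) * Valued.v (t w) := by
      rw [← hrp w, ← map_mul, ← map_mul, e2]
    rw [h2p w, map_mul] at e3
    have e4 : Valued.v (t' w) * Valued.v (2 : w.1.adicCompletion L) =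
        (Valued.v (((resChar L v : ℕ) : LocalRing L v) w) * Valued.v (t w)) * Valued.v (2 : w.1.adicCompletion L) := by
      rw [e3]; ac_rfl
    rw [mul_right_cancel₀ (h20 w) e4]
    exact mul_le_one' hp1 ht1
  have hrt' : r = 1 + twoP L v * t' := by
    funext w
    change r w = 1 + twoP L v w * ((r w - 1) / twoP L v w)
    rw [mul_div_cancel₀ _ (twoP_apply_ne_zero L v w), add_sub_cancel]
  have hrv : ∀ w, Valued.v (r w) = 1 := fun w => by
    rw [show r w = 1 + (r w - 1) by ring, Valuation.map_add_eq_of_lt_left _ (by rw [Valuation.map_one]; exact hr1' w), Valuation.map_one]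
  refine ⟨r, hrr, ⟨t', ht'O, hrt'⟩, funext fun w => ?_, hrv⟩
  -- `(σ r)_w` and `r_w` are both square roots of `u_w` within `|· − 1| < |2|`
  set w₀ : PlacesOver L v := ⟨(IsCMField.complexConj L)⁻¹ • w.1, under_inv_smul_eq (IsCMField.complexConj L) w⟩ with hw₀
  have hσw : conjLocal L (IsCMField.complexConj L) v r w = galAdicCompletionMap (IsCMField.complexConj L) (smul_inv_smul (IsCMField.complexConj L) w.1) (r w₀) := rfl
  have hσu := congrFun hσ w
  rw [conjLocal_apply] at hσu
  refine sqrt_unique L v w ?_ ?_ (hr1 w)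
  · rw [hσw, ← map_mul, (hr w₀).1, (hr w).1]
    exact hσu
  · have h2g : galAdicCompletionMap (IsCMField.complexConj L) (smul_inv_smul (IsCMField.complexConj L) w.1) (2 : w₀.1.adicCompletion L) = 2 := map_ofNat _ 2
    rw [hσw, ← map_one (galAdicCompletionMap (IsCMField.complexConj L) (smul_inv_smul (IsCMField.complexConj L) w.1)), ← map_sub, valued_galAdicCompletionMap, ← h2g,
      valued_galAdicCompletionMap]
    exact hr1 w₀

/-! ## §4 Preimages of one-units of level `m` -/

/-- **`ι(t) = 1 + m·s` with `s ∈ 𝒪_{E_v}`, `m ∈ ℕ` a unit of `E_v` ⇒ `t ≡ 1 (m)` in `𝒪_v`** (the ★ `unitsMap_preimage_mem_ker` pattern at a general natural modulus: `s = m⁻¹(ι t − 1)` is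
`(c ⊗ 1)`-fixed, hence `ι(s₀)`; read `t − 1 = m·s₀` through the injective `ι`). [cite: PlatonovRapinchuk1994, §3.3, §5.1] -/
theorem unitsMap_preimage_mem_ker_natCast {m : ℕ} (hm : IsUnit ((m : ℕ) : LocalRing L v)) {t : (v.adicCompletionIntegers ↥(maximalRealSubfield L))ˣ}
    {s : LocalRing L v} (hs : s ∈ localIntegers L v)
    (hts : (algebraMap (v.adicCompletion ↥(maximalRealSubfield L)) (LocalRing L v)) (t : v.adicCompletionIntegers ↥(maximalRealSubfield L)) = 1 + (m : LocalRing L v) * s) :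
    t ∈ (Units.map (Ideal.Quotient.mk (Ideal.span {((m : ℕ) : v.adicCompletionIntegers ↥(maximalRealSubfield L))})).toMonoidHom).ker := by
  have hσs : conjLocal L (IsCMField.complexConj L) v s = s := by
    have e : s = ↑hm.unit⁻¹ * ((algebraMap (v.adicCompletion ↥(maximalRealSubfield L)) (LocalRing L v)) (t : v.adicCompletionIntegers ↥(maximalRealSubfield L)) - 1) := by
      rw [hts, add_sub_cancel_left, ← mul_assoc, IsUnit.val_inv_mul, one_mul]
    have hσm : conjLocal L (IsCMField.complexConj L) v (↑hm.unit⁻¹ : LocalRing L v) = ↑hm.unit⁻¹ := by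
      rw [Units.val_inv_eq_inv_val, K2E5BetaDetQuasiReflection.conjLocal_inv, IsUnit.unit_spec, map_natCast]
    rw [e, map_mul, hσm, map_sub, map_one]
    congr 2
    exact conjLocal_toLocalRing (IsCMField.complexConj L) v _
  obtain ⟨s₀, hs₀⟩ := Literature.NumberTheory.Rogawski1990.exists_toLocalRing_eq_of_conjLocal_eq v hσs
  change algebraMap _ (LocalRing L v) s₀ = s at hs₀
  have hs₀O : s₀ ∈ v.adicCompletionIntegers ↥(maximalRealSubfield L) := (algebraMap_localRing_mem_localIntegers_iff L v s₀).1 (by rw [hs₀]; exact hs)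
  rw [MonoidHom.mem_ker]
  apply Units.ext
  simp only [Units.coe_map, Units.val_one]
  change Ideal.Quotient.mk _ (t : v.adicCompletionIntegers ↥(maximalRealSubfield L)) = 1
  rw [← (Ideal.Quotient.mk _).map_one, Ideal.Quotient.eq, Ideal.mem_span_singleton']
  refine ⟨⟨s₀, hs₀O⟩, ?_⟩
  have hι : Function.Injective ((algebraMap (v.adicCompletion ↥(maximalRealSubfield L)) (LocalRing L v)).comp
      (v.adicCompletionIntegers ↥(maximalRealSubfield L)).subtype) :=
    (algebraMap_localRing_injective L v).comp Subtype.val_injective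
  apply hι
  rw [map_mul, map_natCast, map_sub, map_one]
  change algebraMap (v.adicCompletion ↥(maximalRealSubfield L)) (LocalRing L v) s₀ * (m : LocalRing L v) =
    algebraMap (v.adicCompletion ↥(maximalRealSubfield L)) (LocalRing L v) (t : v.adicCompletionIntegers ↥(maximalRealSubfield L)) - 1
  rw [hs₀, hts, add_sub_cancel_left, mul_comm]

/-! ## §5 `ι(1 + (2p)²𝒪_v) ≤ Nrd(Λ_v^×(2p))` at every place -/

omit [IsCMField L] in
/-- `((2p)² : ℕ) = 2p · 2p` in `E_v`. [folklore] -/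
theorem natCast_twoP_sq : (((2 * resChar L v) ^ 2 : ℕ) : LocalRing L v) = twoP L v * twoP L v := by
  rw [twoP, Nat.cast_pow, pow_two]

/-- **`ι(1 + (2p)²·𝒪_v) ⊆ Nrd(Λ_v^×(2p)(h))` at EVERY finite place, for EVERY plane `h`**: `ι(t) = 1 + (2p)²·r = s²` with `s` the `σ`-FIXED square root (§3), and the scalar
`s·1₂ ∈ Λ_v^×(2p)` (★ brick I `scalar_mem_quatLocalLevelTwoP`) has `Nrd = s² = ι(t)`. [cite: VignerasLNM800, Ch. II §2, §4 Lemme 4.6] [cite: Serre1979, Ch. XIV §4] [cite: PlatonovRapinchuk1994, §3.3] -/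
theorem levelSq_le_map_det :
    ((Units.map (Ideal.Quotient.mk (Ideal.span {(((2 * resChar L v) ^ 2 : ℕ) : v.adicCompletionIntegers ↥(maximalRealSubfield L))})).toMonoidHom).ker).map
        (Units.map (((algebraMap (v.adicCompletion ↥(maximalRealSubfield L)) (LocalRing L v)).comp
          (v.adicCompletionIntegers ↥(maximalRealSubfield L)).subtype).toMonoidHom)) ≤
      (quatLocalLevelTwoP L H v).map (Matrix.GeneralLinearGroup.det : GL (Fin 2) (LocalRing L v) →* (LocalRing L v)ˣ) := by
  rintro _ ⟨t, ht, rfl⟩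
  rw [SetLike.mem_coe, MonoidHom.mem_ker] at ht
  have ht1 : ((t : v.adicCompletionIntegers ↥(maximalRealSubfield L)) : v.adicCompletionIntegers ↥(maximalRealSubfield L)) - 1 ∈
      Ideal.span {(((2 * resChar L v) ^ 2 : ℕ) : v.adicCompletionIntegers ↥(maximalRealSubfield L))} := by
    rw [← Ideal.Quotient.eq, map_one]
    have h := congrArg Units.val ht
    simpa using h
  obtain ⟨r₀, hr₀⟩ := Ideal.mem_span_singleton'.1 ht1
  set u : LocalRing L v := (algebraMap (v.adicCompletion ↥(maximalRealSubfield L)) (LocalRing L v)) (t : v.adicCompletionIntegers ↥(maximalRealSubfield L)) with hu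
  have hσu : conjLocal L (IsCMField.complexConj L) v u = u := conjLocal_toLocalRing (IsCMField.complexConj L) v _
  set r : LocalRing L v := (algebraMap (v.adicCompletion ↥(maximalRealSubfield L)) (LocalRing L v)) (r₀ : v.adicCompletionIntegers ↥(maximalRealSubfield L)) with hr
  have hrO : r ∈ localIntegers L v := (algebraMap_localRing_mem_localIntegers_iff L v _).2 (SetLike.coe_mem _)
  have hur : u = 1 + twoP L v * twoP L v * r := by
    have h := congrArg ((algebraMap (v.adicCompletion ↥(maximalRealSubfield L)) (LocalRing L v)).comp (v.adicCompletionIntegers ↥(maximalRealSubfield L)).subtype) hr₀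
    rw [map_mul, map_sub, map_one, map_natCast, natCast_twoP_sq] at h
    have h' : r * (twoP L v * twoP L v) = u - 1 := h
    rw [← sub_eq_iff_eq_add', ← h', mul_comm]
  obtain ⟨s, hss, ⟨t', ht', hst'⟩, hσs, hsv⟩ := exists_sqrt_fixed_sq L v hrO hur hσu
  obtain ⟨-, hii⟩ := K2E5BetaDetQuasiReflection.inv_mem_localIntegers_of_valued_eq_one L v hsv
  have hsU : IsUnit s := isUnit_iff_exists_inv.2 ⟨s⁻¹, hii⟩
  refine ⟨Units.map (Matrix.scalar (Fin 2) : LocalRing L v →+* Matrix (Fin 2) (Fin 2) (LocalRing L v)).toMonoidHom hsU.unit,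
    K2E5QuatNrdLevelTwoPImage.scalar_mem_quatLocalLevelTwoP L H v ht' hst' hsv hσs hsU, Units.ext ?_⟩
  rw [Matrix.GeneralLinearGroup.val_det_apply]
  change (Matrix.scalar (Fin 2) (hsU.unit : LocalRing L v)).det = u
  rw [hsU.unit_spec, K2E5QuatNrdLevelTwoPImage.det_scalar_fin_two, hss]

end Summit.HodgeConjecture.HodgeConjecture.Cruxes.H413.K2E5QuatNrdImageDyadic

end
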